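import Summits.BirchSwinnertonDyer.BirchSwinnertonDyer.Theorems.ClassRecordThreeEulerHalvesAtThreeWalkSupplyAtThreeNamedPrint
import HarnessLib

/-!
# `stub_jetchevMaxHLAtThree` (Jetchev 2008 Thm. 1.4 in MAX form at `3 ∥ N`; registered on item 19109
# `EulerHalvesAtThree`) MODULO NAMED PRINT ONLY: seven typed print facts + Poitou–Tate + [GZ86 III (3.1)]
# — no kernel gap, no core-vertex binder, no supply hypothesis (cell `bsd-stepL`, seat
# `bsd-stepL-tam3-p1`, helper toward item 19109)

HONEST FRAMING. Nothing here proves BSD, J₃ or the divisibility of any Heegner point of any curve; the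
registered stub `stub_jetchevMaxHLAtThree` is proved MODULO nine NAMED PRINT hypotheses, each a
published theorem typed ∕ cited in the tree: `h52` McCallum 1991 Prop. 5.2, `h44` McCallum Prop. 4.4,
`h53` Gross 1991 Prop. 5.3, `hD36` Darmon Thm. 3.6, `hrec` Gross §3 (rec), `hGZ` Gross–Zagier I (6.3),
`hmod` modularity, `hPT` Poitou–Tate duality for Selmer structures (`poitouTate_selmerStructure_duality_conj`,
Milne ADT I 4.10 ∕ Howard 2.1.11), `hGZ31` [GZ86 III (3.1)] in the receptacle form (bsd-jet schema,
cite-only). It is therefore a CONDITIONAL result (D-0014), not a discharge; no item closes; 0 classes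
move (T7); `--supports stmt-BirchSwinnertonDyer-19109`. WHAT THIS FILE DOES.
`jetchevMaxHLAtThree_of_facts_of_namedPrint` = display of record p517133 ∘
`selmerSupplyAtThree_of_poitouTate_GZ31` (`…WalkSupplyAtThreeNamedPrint`). The kernel: this seat's §6 walk
([J] Prop. 6.4 ∘ Thm. 6.3 on the row objects, Lemma 6.1, `hfin`, `hordκ`, `hκt`, Lemma 5.2 (iii) primal,
[J] §4.2, global transverse family, carrier package, root-class transport) + bsd-jet road K's bricks
(Poitou–Tate packages, Weil datum, stringent family and (δ), [J] L.5.2 (i)(ii), Gross §3 dihedral,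
Howard 2.1.9 (ii), Kodaira–Néron, Howard L.2.7.3 `htr`, Jetchev Prop. 4.9 `h49str`, ring class fields) +
x11b3 ∕ corner-p1 bricks (GZ31 Kummer lemma, avatar, cartesian transports). Compare bsd-jet's K3 END
FORM: its residual keeps the conjecture-tagged core-vertex reading K5; here Prop. 6.4 is kernel.
References (locators only; no cited FACT is declared): [cite: Jetchev2008, Thm. 1.4 (p. 812), §3–§6,
Proof of Thm. 1.4 (p. 825)] [cite: McCallumLMS1991, §4 Prop. 4.4, §5 Prop. 5.2] [cite: GrossLMS1991, §3,
Prop. 5.3, Prop. 6.2 (1)] [cite: GrossZagier1986, I (6.3), III (3.1)] [cite: Darmon2004, Thm. 3.6, Prop. 3.11]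
[cite: Howard2004HeegnerKolyvagin, Prop. 2.1.7, 2.1.9, Thm. 2.1.11, Lemma 2.7.3] [cite: MazurRubin2004,
Lemma 1.2.4] [cite: MilneADT2006, Ch. I, Cor. 3.4, Thm. 4.10(b)]. Design: one theorem, no definitions;
`K : Type`. Axioms: `propext`, `Classical.choice`, `Quot.sound`.
-/

set_option autoImplicit false

noncomputable section

open scoped Classical NumberField Pointwise

namespace Summit.BirchSwinnertonDyer.Rank1Residual.X11b.Three.Koly

open WeierstrassCurve IsDedekindDomain NumberField Field Literature.NumberTheory.EllipticCurves
  Literature.NumberTheory.EllipticCurves.ModularForms Literature.NumberTheory.EllipticCurves.Jetchev2008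
  Literature.NumberTheory.EllipticCurves.KolyvaginCocycle
  Literature.NumberTheory.EllipticCurves.Rank1Residual Literature.NumberTheory.GaloisRepresentations
  Literature.NumberTheory.GaloisRepresentations.DiscreteGaloisModule
  Literature.NumberTheory.GaloisCohomology Literature.NumberTheory.Automorphic
  Summit.BirchSwinnertonDyer.Rank1Residual.X11b Summit.BirchSwinnertonDyer.Rank1Residual.JET
  Summit.BirchSwinnertonDyer.Rank1Residual.JET.SelmerVocabulary
  Summit.BirchSwinnertonDyer.Rank1Residual.JET.Walk

set_option maxHeartbeats 800000 in
/-- **`stub_jetchevMaxHLAtThree` VERBATIM modulo NAMED PRINT only** (seven typed print facts + Poitou–Tate +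
[GZ86 III (3.1)]; CONDITIONAL, nothing asserted about any curve) — no core-vertex binder, no supply hypothesis, no local
print-to-type hypothesis; see the module docstring. [cite: Jetchev2008, Thm. 1.4 (p. 812), Proof of Thm. 1.4 (p. 825)]
[cite: McCallumLMS1991, §4 Prop. 4.4, §5 Prop. 5.2] [cite: GrossLMS1991, Prop. 5.3]
[cite: GrossZagier1986, III (3.1)] -/
theorem jetchevMaxHLAtThree_of_facts_of_namedPrint
    -- PRINT FACTS (typed)
    (h52 : McCallum1991.prop52_exists_conductor_kolyvaginClass_order_eq)
    (h44 : McCallum1991.prop44_localOrder_kolyvaginClass_mul_eq)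
    (h53 : ∀ (W : WeierstrassCurve ℚ) (K : Type) [Field K] [NumberField K],
      heegnerPointOfConductor_conj_sub_neg_rootNumber_smul W K)
    (hD36 : ∀ (N : ℕ) [NeZero N] (W : WeierstrassCurve ℚ) (K : Type) [Field K] [NumberField K],
      phi_heegnerTau_mem_singularModuliField N W K)
    (hrec : ∀ (N : ℕ) [NeZero N] (W : WeierstrassCurve ℚ) (K : Type) [Field K] [NumberField K],
      heegnerPointOfConductor_one_galoisConj N W K)
    (hGZ : ∀ (N : ℕ) [NeZero N] (W : WeierstrassCurve ℚ) (K : Type) [Field K] [NumberField K],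
      gross_zagier N W K)
    (hmod : hasEntireLFunction_rat)
    -- NAMED PRINT
    -- NAMED PRINT (cite-only)
    (hPT : ∀ (K : Type) [Field K] [NumberField K], poitouTate_selmerStructure_duality_conj K)
    (hGZ31 : ∀ (W : WeierstrassCurve ℚ) [W.IsElliptic] [NeZero (W.conductorNorm ℤ)]
      (K : Type) [Field K] [NumberField K] (p : ℕ) [Fact p.Prime]
      (Dt : ModularParametrizationData W (W.conductorNorm ℤ)) (β : ℤ) (ι : K →+* ℂ)
      [∀ j : ℕ, NumberField (ringClassField K ι j)],
      ∃ n' : ℤ, IsCoprime (p : ℤ) n' ∧ ∀ (m : ℕ) (dm : KolyvaginHeegnerData Dt β ι m)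
        (γ : ringClassField K ι m ≃ₐ[ℚ] ringClassField K ι m), γ ∈ ringClassGal ι m →
        ∀ v : HeightOneSpectrum (𝓞 K), ¬ (W.baseChange K).HasGoodReductionAt v →
          n' • pointsMap (W.baseChange K) (v.adicCompletion K)
              (dm.toGeomPoints (pointGalHom W (ringClassField K ι m) γ dm.y)) ∈
            E0Receptacle (W.baseChange K) v ∧
          ∀ (ℓ : ℕ), ℓ ∈ m.primeFactors → ∀ (dm' : KolyvaginHeegnerData Dt β ι (m / ℓ))
            (hle : ringClassField K ι (m / ℓ) ≤ ringClassField K ι m),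
            n' • pointsMap (W.baseChange K) (v.adicCompletion K)
                (dm.toGeomPoints (pointGalHom W (ringClassField K ι m) γ
                  (WeierstrassCurve.Affine.Point.map (W' := W)
                    ((RingClassField.inclusion ι hle).restrictScalars ℚ) dm'.y))) ∈
              E0Receptacle (W.baseChange K) v)
    :
    ∀ (W : WeierstrassCurve ℚ) [W.IsElliptic] [W.IsGloballyMinimal] [NeZero (W.conductorNorm ℤ)]
      (K : Type) [Field K] [NumberField K]
      (Dt : ModularParametrizationData W (W.conductorNorm ℤ)) (β : ℤ) (ι : K →+* ℂ),
      W.analyticRank = 1 → W.HasMultiplicativeReductionAtPrime 3 → Surj W 3 →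
      IsImaginaryQuadratic K → SatisfiesHeegnerHypothesis (W.conductorNorm ℤ) K →
      Odd (NumberField.discr K) → (W.quadraticTwist (NumberField.discr K : ℚ)).entireLFunction 1 ≠ 0 →
      (4 * (W.conductorNorm ℤ : ℤ)) ∣ β ^ 2 - NumberField.discr K → ¬ (3 : ℤ) ∣ Dt.c →
      ∀ (v : HeightOneSpectrum (𝓞 ℚ)) (s : ℕ), s ≤ padicValNat 3 (W.tamagawaNumberAt v) →
        ∀ (n : ℕ) (d : KolyvaginHeegnerData Dt β ι n), Squarefree n →
          (∀ ℓ ∈ n.primeFactors, Zhang2014.IsKolyvaginPrime (W.conductorNorm ℤ) W K 3 ℓ ∧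
            s ≤ Zhang2014.kolyvaginIndex W 3 ℓ) → PDiv d 3 s
      :=
  jetchevMaxHLAtThree_of_facts_of_selmerSupply h52 h44 h53 hD36 hrec hGZ hmod
    (selmerSupplyAtThree_of_poitouTate_GZ31 hPT hGZ31)

end Summit.BirchSwinnertonDyer.Rank1Residual.X11b.Three.Koly

end
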